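import Mathlib
import Literature.Geometry.Symplectic.SteinBall
import Literature.Geometry.Symplectic.JHolomorphicMap
import HarnessLib

/-!
# Stub `stub_modelPair` — the model pair `(J₀, |dw|²/(R² - ‖w‖²))` has holomorphic curvature `≤ -2`

Crux `HyperbolicEnd` (stmt-SmoothPoincare4-7825), line `Sketch`.

For `g : ℂ → ℝ⁴ = ℂ²`, `C^∞` and `J₀`-holomorphic on an open `U ⊆ ℂ` with `‖g‖ < R` there, the
density `μ = ‖∂ₓ g‖² / (R² - ‖g‖²)` is `C²` on `U` and `4 μ³ ≤ μ Δμ - |∇μ|²` on `U`.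

Proof: the two complex components `G₁, G₂` of `g` are holomorphic on `U` (their real derivative
commutes with `i`), `‖∂ₓ g‖² = ‖G₁'‖² + ‖G₂'‖² =: N`, `R² - ‖g‖² = R² - ‖G₁‖² - ‖G₂‖² =: h`,
`μ = N / h`.  Along each real line `t ↦ z + t v` (`v = 1, i`) the quotient rule gives
`h⁴ (μ μ'' - μ'²) = h² (N N'' - N'²) - N² (h h'' - h'²)`; summing over `v = 1, i`, for holomorphic
data `Σ_v (N N'' - N'²) = 4 |G₁' G₂'' - G₂' G₁''|² ≥ 0` and
`Σ_v (h h'' - h'²) = -4 h N - 4 |conj G₁ · G₁' + conj G₂ · G₂'|²`, whence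
`h⁴ (μ Δμ - |∇μ|²) ≥ 4 h N³`, i.e. `μ Δμ - |∇μ|² ≥ 4 μ³`.
-/

noncomputable section

-- the prescribed crux namespace repeats the component `SmoothPoincare4`
set_option linter.dupNamespace false

open scoped Manifold ContDiff Topology RealInnerProductSpace ComplexConjugate
open Laplacian Set Complex
open Literature.Geometry.Symplectic Literature.Topology.FourManifolds

namespace Summit.SmoothPoincare4.SmoothPoincare4.Cruxes.HyperbolicEnd.Sketch

/-! ### One-variable reduction: derivatives along real lines -/

/-- **Line lemma.** For a real function `f` on `ℂ`, `C²` at `z`, the directional derivatives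
`Df(z) v` and `D²f(z)[v, v]` are the first and second derivatives at `0` of the slice
`t ↦ f (z + t v)`; here read off from one-variable `HasDerivAt` data. [folklore] -/
theorem fderiv_iteratedFDeriv_of_line {f : ℂ → ℝ} {z v : ℂ} (hf : ContDiffAt ℝ 2 f z)
    {m₁ : ℝ → ℝ} {m₂ : ℝ}
    (h₁ : ∀ᶠ t in 𝓝 (0 : ℝ), HasDerivAt (fun s : ℝ => f (z + s * v)) (m₁ t) t)
    (h₂ : HasDerivAt m₁ m₂ 0) :
    fderiv ℝ f z v = m₁ 0 ∧ iteratedFDeriv ℝ 2 f z ![v, v] = m₂ := by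
  -- the line through `z` in direction `v`
  set γ : ℝ → ℂ := fun t => z + t * v with hγ_def
  have hγ : ∀ t, HasDerivAt γ v t := fun t => by
    have h := (((hasDerivAt_id (t : ℂ)).mul_const v).const_add z).comp_ofReal
    simpa [hγ_def] using h
  have hγ0 : γ 0 = z := by simp [hγ_def]
  -- `f` is differentiable near `z`, `Df` is differentiable at `z`
  have hev : ∀ᶠ y in 𝓝 z, DifferentiableAt ℝ f y := by
    filter_upwards [hf.eventually (by simp)] with y hy
    exact hy.differentiableAt (by simp)
  have hD : DifferentiableAt ℝ (fderiv ℝ f) z :=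
    (hf.fderiv_right (m := 1) (by norm_num)).differentiableAt one_ne_zero
  -- the slice and its first derivative near `0`
  have hφ' : ∀ᶠ t in 𝓝 (0 : ℝ), HasDerivAt (fun s : ℝ => f (z + s * v)) (fderiv ℝ f (γ t) v) t := by
    have : ∀ᶠ t in 𝓝 (0 : ℝ), DifferentiableAt ℝ f (γ t) := by
      have hcont : ContinuousAt γ 0 := (hγ 0).continuousAt
      rw [← hγ0] at hev
      exact hcont.eventually hev
    filter_upwards [this] with t ht
    exact ht.hasFDerivAt.comp_hasDerivAt t (hγ t)
  -- so `m₁` agrees with `t ↦ Df(γ t) v` near `0`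
  have hm₁ : m₁ =ᶠ[𝓝 0] fun t => fderiv ℝ f (γ t) v := by
    filter_upwards [h₁, hφ'] with t ht ht'
    exact ht.unique ht'
  refine ⟨?_, ?_⟩
  · have h0 := hm₁.eq_of_nhds
    simp only [hγ0] at h0
    exact h0.symm
  · -- second derivative of the slice at `0`
    have h1 : HasDerivAt (fderiv ℝ f ∘ γ) (fderiv ℝ (fderiv ℝ f) (γ 0) v) 0 := by
      have hD' : DifferentiableAt ℝ (fderiv ℝ f) (γ 0) := by rw [hγ0]; exact hD
      exact hD'.hasFDerivAt.comp_hasDerivAt 0 (hγ 0)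
    rw [hγ0] at h1
    have h2 := h1.clm_apply (hasDerivAt_const (0 : ℝ) v)
    simp only [ContinuousLinearMap.map_zero, add_zero, Function.comp_apply] at h2
    -- `h2 : HasDerivAt (fun t => fderiv ℝ f (γ t) v) (fderiv ℝ (fderiv ℝ f) z v v) 0`
    have h3 : HasDerivAt m₁ (fderiv ℝ (fderiv ℝ f) z v v) 0 := h2.congr_of_eventuallyEq hm₁
    rw [iteratedFDeriv_two_apply]
    simpa using (h₂.unique h3).symm

/-- Chain rule along the real line `t ↦ z + t v` for a function with a complex derivative.
[folklore] -/
theorem hasDerivAt_comp_line {F : ℂ → ℂ} {F' z v : ℂ} {t : ℝ}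
    (hF : HasDerivAt F F' (z + t * v)) :
    HasDerivAt (fun s : ℝ => F (z + s * v)) (v * F') t := by
  have hline : HasDerivAt (fun u : ℂ => z + u * v) v (t : ℂ) := by
    simpa using ((hasDerivAt_id (t : ℂ)).mul_const v).const_add z
  have h := (hF.comp (t : ℂ) hline).comp_ofReal
  simpa [Function.comp_def, mul_comm] using h

/-- `d/dt ‖F(z + t v)‖² = 2 ⟪F, v F'⟫` along a real line, for `F` with complex derivative `F'`.
[folklore] -/
theorem hasDerivAt_norm_sq_line {F : ℂ → ℂ} {F' z v : ℂ} {t : ℝ}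
    (hF : HasDerivAt F F' (z + t * v)) :
    HasDerivAt (fun s : ℝ => ‖F (z + s * v)‖ ^ 2) (2 * ⟪F (z + t * v), v * F'⟫) t :=
  (hasDerivAt_comp_line hF).norm_sq

/-- `d/dt (2 ⟪F(z + t v), v F'(z + t v)⟫) = 2 (⟪F, v (v F'')⟫ + ⟪v F', v F'⟫)` along a real line.
[folklore] -/
theorem hasDerivAt_two_inner_line {F F' F'' : ℂ → ℂ} {z v : ℂ} {t : ℝ}
    (hF : HasDerivAt F (F' (z + t * v)) (z + t * v))
    (hF' : HasDerivAt F' (F'' (z + t * v)) (z + t * v)) :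
    HasDerivAt (fun s : ℝ => 2 * ⟪F (z + s * v), v * F' (z + s * v)⟫)
      (2 * (⟪F (z + t * v), v * (v * F'' (z + t * v))⟫ +
        ⟪v * F' (z + t * v), v * F' (z + t * v)⟫)) t := by
  have h1 := hasDerivAt_comp_line hF
  have h2 := (hasDerivAt_comp_line hF').const_mul v
  exact (h1.inner (𝕜 := ℝ) h2).const_mul 2

/-! ### The algebra -/

/-- **Quotient-rule algebra.** With `μ = n / K` along two directions (`X`, `P` the first/second
derivative data of numerator and denominator in direction `1`, `Y`, `Q` in direction `i`):
if `n ΔN - |∇N|² ≥ 0` and `-(4 K n) - (K ΔK - |∇K|²) ≥ 0` then `4 μ³ ≤ μ Δμ - |∇μ|²`.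
[folklore] -/
theorem alg_ineq {K n X1 X2 Y1 Y2 P1 P2 Q1 Q2 : ℝ} (hK : 0 < K)
    (hN : 0 ≤ n * (X2 + Y2) - (X1 ^ 2 + Y1 ^ 2))
    (hH : 0 ≤ -(4 * K * n) - (K * (P2 + Q2) - (P1 ^ 2 + Q1 ^ 2))) :
    2 * 2 * (n / K) ^ 3 ≤
      n / K *
          (((X2 * K - n * P2) * K ^ 2 - (X1 * K - n * P1) * (2 * K * P1)) / (K ^ 2) ^ 2 +
            ((Y2 * K - n * Q2) * K ^ 2 - (Y1 * K - n * Q1) * (2 * K * Q1)) / (K ^ 2) ^ 2) -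
        (((X1 * K - n * P1) / K ^ 2) ^ 2 + ((Y1 * K - n * Q1) / K ^ 2) ^ 2) := by
  rw [← sub_nonneg]
  have hK0 : K ≠ 0 := hK.ne'
  have key : n / K *
          (((X2 * K - n * P2) * K ^ 2 - (X1 * K - n * P1) * (2 * K * P1)) / (K ^ 2) ^ 2 +
            ((Y2 * K - n * Q2) * K ^ 2 - (Y1 * K - n * Q1) * (2 * K * Q1)) / (K ^ 2) ^ 2) -
        (((X1 * K - n * P1) / K ^ 2) ^ 2 + ((Y1 * K - n * Q1) / K ^ 2) ^ 2) -
        2 * 2 * (n / K) ^ 3 =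
      (K ^ 2 * (n * (X2 + Y2) - (X1 ^ 2 + Y1 ^ 2)) +
        n ^ 2 * (-(4 * K * n) - (K * (P2 + Q2) - (P1 ^ 2 + Q1 ^ 2)))) / K ^ 4 := by
    field_simp
    ring
  rw [key]
  positivity

/-- **Lagrange / Cauchy–Schwarz for the numerator.** For `N = ‖A₁‖² + ‖A₂‖²` with holomorphic
`A_k` (values `a_k`, derivatives `b_k`, second derivatives `d_k`):
`N ΔN - |∇N|² = 4 |a₁ b₂ - a₂ b₁|² ≥ 0`. [folklore] -/
theorem numerator_nonneg (a₁ a₂ b₁ b₂ d₁ d₂ : ℂ) :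
    0 ≤ (‖a₁‖ ^ 2 + ‖a₂‖ ^ 2) *
        (2 * (⟪a₁, 1 * (1 * d₁)⟫ + ⟪1 * b₁, 1 * b₁⟫) +
            2 * (⟪a₂, 1 * (1 * d₂)⟫ + ⟪1 * b₂, 1 * b₂⟫) +
          (2 * (⟪a₁, I * (I * d₁)⟫ + ⟪I * b₁, I * b₁⟫) +
            2 * (⟪a₂, I * (I * d₂)⟫ + ⟪I * b₂, I * b₂⟫))) -
      ((2 * ⟪a₁, 1 * b₁⟫ + 2 * ⟪a₂, 1 * b₂⟫) ^ 2 +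
        (2 * ⟪a₁, I * b₁⟫ + 2 * ⟪a₂, I * b₂⟫) ^ 2) := by
  simp only [Complex.inner, Complex.sq_norm, Complex.normSq_apply, mul_re, mul_im, conj_re,
    conj_im, I_re, I_im, one_re, one_im]
  nlinarith [sq_nonneg (a₁.re * b₂.re - a₁.im * b₂.im - a₂.re * b₁.re + a₂.im * b₁.im),
    sq_nonneg (a₁.re * b₂.im + a₁.im * b₂.re - a₂.re * b₁.im - a₂.im * b₁.re)]

/-- **The denominator.** For `K = R² - (‖C₁‖² + ‖C₂‖²)` with holomorphic `C_k` (values `c_k`,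
derivatives `a_k`, second derivatives `b_k`) and `n = ‖a₁‖² + ‖a₂‖²`:
`-(4 K n) - (K ΔK - |∇K|²) = 4 |conj c₁ · a₁ + conj c₂ · a₂|² ≥ 0`. [folklore] -/
theorem denominator_nonneg (K : ℝ) (c₁ c₂ a₁ a₂ b₁ b₂ : ℂ) :
    0 ≤ -(4 * K * (‖a₁‖ ^ 2 + ‖a₂‖ ^ 2)) -
      (K * (-(2 * (⟪c₁, 1 * (1 * b₁)⟫ + ⟪1 * a₁, 1 * a₁⟫) +
              2 * (⟪c₂, 1 * (1 * b₂)⟫ + ⟪1 * a₂, 1 * a₂⟫)) +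
            -(2 * (⟪c₁, I * (I * b₁)⟫ + ⟪I * a₁, I * a₁⟫) +
              2 * (⟪c₂, I * (I * b₂)⟫ + ⟪I * a₂, I * a₂⟫))) -
        ((-(2 * ⟪c₁, 1 * a₁⟫ + 2 * ⟪c₂, 1 * a₂⟫)) ^ 2 +
          (-(2 * ⟪c₁, I * a₁⟫ + 2 * ⟪c₂, I * a₂⟫)) ^ 2)) := by
  simp only [Complex.inner, Complex.sq_norm, Complex.normSq_apply, mul_re, mul_im, conj_re,
    conj_im, I_re, I_im, one_re, one_im]
  nlinarith [sq_nonneg (c₁.re * a₁.re + c₁.im * a₁.im + c₂.re * a₂.re + c₂.im * a₂.im),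
    sq_nonneg (c₁.re * a₁.im - c₁.im * a₁.re + c₂.re * a₂.im - c₂.im * a₂.re)]

/-! ### The model computation along one direction -/

/-- **Regularity of the model density.** For `G₁, G₂` holomorphic on an open `U` with
`‖G₁‖² + ‖G₂‖² < R²` there, `μ = (‖G₁'‖² + ‖G₂'‖²) / (R² - (‖G₁‖² + ‖G₂‖²))` is `C²` (indeed
real-analytic) at every point of `U`. [folklore] -/
theorem model_contDiffAt {R : ℝ} {U : Set ℂ} {G₁ G₂ : ℂ → ℂ} (hU : IsOpen U)
    (hG₁ : DifferentiableOn ℂ G₁ U) (hG₂ : DifferentiableOn ℂ G₂ U)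
    (hlt : ∀ w ∈ U, ‖G₁ w‖ ^ 2 + ‖G₂ w‖ ^ 2 < R ^ 2) {z : ℂ} (hz : z ∈ U) :
    ContDiffAt ℝ 2 (fun w => (‖deriv G₁ w‖ ^ 2 + ‖deriv G₂ w‖ ^ 2) /
      (R ^ 2 - (‖G₁ w‖ ^ 2 + ‖G₂ w‖ ^ 2))) z := by
  have hA₁ : AnalyticOnNhd ℂ G₁ U := hG₁.analyticOnNhd hU
  have hA₂ : AnalyticOnNhd ℂ G₂ U := hG₂.analyticOnNhd hU
  have hsm : ∀ {F : ℂ → ℂ}, AnalyticOnNhd ℂ F U → ContDiffAt ℝ 2 (fun w => ‖F w‖ ^ 2) z :=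
    fun hF => ((hF z hz).contDiffAt.restrict_scalars ℝ).norm_sq ℝ
  exact ((hsm hA₁.deriv).add (hsm hA₂.deriv)).div (contDiffAt_const.sub ((hsm hA₁).add (hsm hA₂)))
    (sub_pos.2 (hlt z hz)).ne'

/-- **Direction lemma.** For `G₁, G₂` holomorphic on an open `U ∋ z` with `‖G₁‖² + ‖G₂‖² < R²`
on `U` and `μ = (‖G₁'‖² + ‖G₂'‖²) / (R² - (‖G₁‖² + ‖G₂‖²))`: the first and second derivatives
of `μ` at `z` in the direction `v`, by the quotient rule along the line `t ↦ z + t v`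
(`n, K` the values, `X1, P1` the first and `X2, P2` the second `t`-derivatives at `0` of
numerator and denominator). [folklore] -/
theorem model_line {R : ℝ} {U : Set ℂ} {G₁ G₂ : ℂ → ℂ} (hU : IsOpen U)
    (hG₁ : DifferentiableOn ℂ G₁ U) (hG₂ : DifferentiableOn ℂ G₂ U)
    (hlt : ∀ w ∈ U, ‖G₁ w‖ ^ 2 + ‖G₂ w‖ ^ 2 < R ^ 2) {z : ℂ} (hz : z ∈ U) (v : ℂ)
    {n K X1 X2 P1 P2 : ℝ}
    (hn : n = ‖deriv G₁ z‖ ^ 2 + ‖deriv G₂ z‖ ^ 2)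
    (hK : K = R ^ 2 - (‖G₁ z‖ ^ 2 + ‖G₂ z‖ ^ 2))
    (hX1 : X1 = 2 * ⟪deriv G₁ z, v * deriv (deriv G₁) z⟫ + 2 * ⟪deriv G₂ z, v * deriv (deriv G₂) z⟫)
    (hX2 : X2 = 2 * (⟪deriv G₁ z, v * (v * deriv (deriv (deriv G₁)) z)⟫ +
          ⟪v * deriv (deriv G₁) z, v * deriv (deriv G₁) z⟫) +
        2 * (⟪deriv G₂ z, v * (v * deriv (deriv (deriv G₂)) z)⟫ +
          ⟪v * deriv (deriv G₂) z, v * deriv (deriv G₂) z⟫))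
    (hP1 : P1 = -(2 * ⟪G₁ z, v * deriv G₁ z⟫ + 2 * ⟪G₂ z, v * deriv G₂ z⟫))
    (hP2 : P2 = -(2 * (⟪G₁ z, v * (v * deriv (deriv G₁) z)⟫ + ⟪v * deriv G₁ z, v * deriv G₁ z⟫) +
        2 * (⟪G₂ z, v * (v * deriv (deriv G₂) z)⟫ + ⟪v * deriv G₂ z, v * deriv G₂ z⟫))) :
    fderiv ℝ (fun w => (‖deriv G₁ w‖ ^ 2 + ‖deriv G₂ w‖ ^ 2) /
        (R ^ 2 - (‖G₁ w‖ ^ 2 + ‖G₂ w‖ ^ 2))) z v = (X1 * K - n * P1) / K ^ 2 ∧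
      iteratedFDeriv ℝ 2 (fun w => (‖deriv G₁ w‖ ^ 2 + ‖deriv G₂ w‖ ^ 2) /
          (R ^ 2 - (‖G₁ w‖ ^ 2 + ‖G₂ w‖ ^ 2))) z ![v, v] =
        ((X2 * K - n * P2) * K ^ 2 - (X1 * K - n * P1) * (2 * K * P1)) / (K ^ 2) ^ 2 := by
  -- all complex derivatives exist on `U`
  have hA₁ : AnalyticOnNhd ℂ G₁ U := hG₁.analyticOnNhd hU
  have hA₂ : AnalyticOnNhd ℂ G₂ U := hG₂.analyticOnNhd hU
  have hd : ∀ {F : ℂ → ℂ}, AnalyticOnNhd ℂ F U → ∀ w ∈ U, HasDerivAt F (deriv F w) w :=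
    fun hF w hw => (hF w hw).differentiableAt.hasDerivAt
  -- the denominator does not vanish on `U`
  have hKne : ∀ w ∈ U, R ^ 2 - (‖G₁ w‖ ^ 2 + ‖G₂ w‖ ^ 2) ≠ 0 :=
    fun w hw => (sub_pos.2 (hlt w hw)).ne'
  -- `μ` is `C²` at `z`
  have hcd := model_contDiffAt hU hG₁ hG₂ hlt hz
  -- the line `t ↦ z + t v` stays in `U` for small `t`
  have hnear : ∀ᶠ t : ℝ in 𝓝 0, z + (t : ℂ) * v ∈ U := by
    have hc : Continuous fun t : ℝ => z + (t : ℂ) * v := by fun_prop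
    have h0 : U ∈ 𝓝 (z + ((0 : ℝ) : ℂ) * v) := by simpa using hU.mem_nhds hz
    exact hc.continuousAt.preimage_mem_nhds h0
  -- first derivatives of numerator and denominator along the line, inside `U`
  have hN : ∀ t : ℝ, z + (t : ℂ) * v ∈ U → HasDerivAt
      (fun s : ℝ => ‖deriv G₁ (z + s * v)‖ ^ 2 + ‖deriv G₂ (z + s * v)‖ ^ 2)
      (2 * ⟪deriv G₁ (z + t * v), v * deriv (deriv G₁) (z + t * v)⟫ +
        2 * ⟪deriv G₂ (z + t * v), v * deriv (deriv G₂) (z + t * v)⟫) t := fun t ht =>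
    (hasDerivAt_norm_sq_line (hd hA₁.deriv _ ht)).add (hasDerivAt_norm_sq_line (hd hA₂.deriv _ ht))
  have hD : ∀ t : ℝ, z + (t : ℂ) * v ∈ U → HasDerivAt
      (fun s : ℝ => R ^ 2 - (‖G₁ (z + s * v)‖ ^ 2 + ‖G₂ (z + s * v)‖ ^ 2))
      (-(2 * ⟪G₁ (z + t * v), v * deriv G₁ (z + t * v)⟫ +
        2 * ⟪G₂ (z + t * v), v * deriv G₂ (z + t * v)⟫)) t := fun t ht =>
    ((hasDerivAt_norm_sq_line (hd hA₁ _ ht)).add (hasDerivAt_norm_sq_line (hd hA₂ _ ht))).const_sub _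
  -- second derivatives at `0`, and the quotient rule (twice)
  have h0 : z + ((0 : ℝ) : ℂ) * v ∈ U := by simpa using hz
  have hN' := (hasDerivAt_two_inner_line (hd hA₁.deriv _ h0) (hd hA₁.deriv.deriv _ h0)).add
    (hasDerivAt_two_inner_line (hd hA₂.deriv _ h0) (hd hA₂.deriv.deriv _ h0))
  have hD' := ((hasDerivAt_two_inner_line (hd hA₁ _ h0) (hd hA₁.deriv _ h0)).add
    (hasDerivAt_two_inner_line (hd hA₂ _ h0) (hd hA₂.deriv _ h0))).neg
  have h₁ := hnear.mono fun t ht => (hN t ht).div (hD t ht) (hKne _ ht)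
  have h₂ := ((hN'.mul (hD 0 h0)).sub ((hN 0 h0).mul hD')).div ((hD 0 h0).pow 2)
    (pow_ne_zero 2 (hKne _ h0))
  obtain ⟨e1, e2⟩ := fderiv_iteratedFDeriv_of_line hcd h₁ h₂
  subst hn hK hX1 hX2 hP1 hP2
  refine ⟨?_, ?_⟩
  · rw [e1]
    simp only [ofReal_zero, zero_mul, add_zero]
  · rw [e2]
    simp only [Pi.pow_apply, Pi.mul_apply, Pi.sub_apply, Pi.add_apply, Pi.neg_apply, ofReal_zero,
      zero_mul, add_zero, Nat.cast_ofNat, Nat.add_one_sub_one, pow_one]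
    ring

/-- **The model inequality in complex coordinates.** For `G₁, G₂` holomorphic on an open `U`
with `‖G₁‖² + ‖G₂‖² < R²` there, `μ = (‖G₁'‖² + ‖G₂'‖²) / (R² - (‖G₁‖² + ‖G₂‖²))` satisfies
`4 μ³ ≤ μ Δμ - |∇μ|²` on `U` (the metric `|dw|² / (R² - ‖w‖²)` on the ball `B_R ⊂ ℂ²` has
holomorphic curvature `≤ -2` along complex curves). [folklore] -/
theorem model_ineq {R : ℝ} {U : Set ℂ} {G₁ G₂ : ℂ → ℂ} (hU : IsOpen U)
    (hG₁ : DifferentiableOn ℂ G₁ U) (hG₂ : DifferentiableOn ℂ G₂ U)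
    (hlt : ∀ w ∈ U, ‖G₁ w‖ ^ 2 + ‖G₂ w‖ ^ 2 < R ^ 2) {z : ℂ} (hz : z ∈ U) :
    2 * 2 * ((‖deriv G₁ z‖ ^ 2 + ‖deriv G₂ z‖ ^ 2) / (R ^ 2 - (‖G₁ z‖ ^ 2 + ‖G₂ z‖ ^ 2))) ^ 3 ≤
      (‖deriv G₁ z‖ ^ 2 + ‖deriv G₂ z‖ ^ 2) / (R ^ 2 - (‖G₁ z‖ ^ 2 + ‖G₂ z‖ ^ 2)) *
          (Δ (fun w => (‖deriv G₁ w‖ ^ 2 + ‖deriv G₂ w‖ ^ 2) /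
            (R ^ 2 - (‖G₁ w‖ ^ 2 + ‖G₂ w‖ ^ 2)))) z -
        ((fderiv ℝ (fun w => (‖deriv G₁ w‖ ^ 2 + ‖deriv G₂ w‖ ^ 2) /
            (R ^ 2 - (‖G₁ w‖ ^ 2 + ‖G₂ w‖ ^ 2))) z 1) ^ 2 +
          (fderiv ℝ (fun w => (‖deriv G₁ w‖ ^ 2 + ‖deriv G₂ w‖ ^ 2) /
            (R ^ 2 - (‖G₁ w‖ ^ 2 + ‖G₂ w‖ ^ 2))) z I) ^ 2) := by
  obtain ⟨e1, e2⟩ := model_line hU hG₁ hG₂ hlt hz 1 rfl rfl rfl rfl rfl rfl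
  obtain ⟨f1, f2⟩ := model_line hU hG₁ hG₂ hlt hz I rfl rfl rfl rfl rfl rfl
  rw [InnerProductSpace.laplacian_eq_iteratedFDeriv_complexPlane]
  beta_reduce
  rw [e1, e2, f1, f2]
  exact alg_ineq (sub_pos.2 (hlt z hz)) (numerator_nonneg _ _ _ _ _ _)
    (denominator_nonneg _ _ _ _ _ _ _)

/-! ### The statement for `g : ℂ → ℝ⁴` -/

/-- A real-linear functional pair `L : ℝ⁴ → ℂ` reading `J₀` as multiplication by `i` turns a
`J₀`-holomorphic `g` into a holomorphic `L ∘ g`, with complex derivative `L (∂ₓ g)`. [folklore] -/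
theorem hasDerivAt_comp_of_J₀ {U : Set ℂ} {g : ℂ → EuclideanSpace ℝ (Fin 4)} (hU : IsOpen U)
    (hg : ContDiffOn ℝ ∞ g U)
    (hJ : ∀ z ∈ U, ∀ ζ : ℂ, fderiv ℝ g z (Complex.I * ζ) = stdComplexStructure (fderiv ℝ g z ζ))
    (L : EuclideanSpace ℝ (Fin 4) →L[ℝ] ℂ) (hL : ∀ u, L (stdComplexStructure u) = I * L u)
    {w : ℂ} (hw : w ∈ U) :
    HasDerivAt (fun w => L (g w)) (L (fderiv ℝ g w 1)) w := by
  have hgd : DifferentiableAt ℝ g w := (hg.contDiffAt (hU.mem_nhds hw)).differentiableAt (by simp)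
  have h1 : HasFDerivAt (fun w => L (g w)) (L.comp (fderiv ℝ g w)) w :=
    L.hasFDerivAt.comp w hgd.hasFDerivAt
  obtain ⟨g', hg'⟩ := exists_restrictScalars_eq_of_map_mul_I (L.comp (fderiv ℝ g w)) fun ζ => by
    simp [hJ w hw ζ, hL]
  have h2 : HasFDerivAt (fun w => L (g w)) g' w := hasFDerivAt_of_restrictScalars ℝ h1 hg'
  have h3 := congrArg (fun T : ℂ →L[ℝ] ℂ => T 1) hg'
  have h4 : g' 1 = L (fderiv ℝ g w 1) := by simpa using h3
  exact h2.hasDerivAt.congr_deriv h4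

/-- **Stub (P3, flat) — the model pair has holomorphic curvature `≤ -2`.** On the ball
`B_R ⊂ ℝ⁴ = ℂ²` with the standard complex structure `J₀` (`stdComplexStructure a =
(-a₁, a₀, -a₃, a₂)`), the conformally flat Hermitian metric `|dw|²/(R² - ‖w‖²)` is a
hyperbolicity certificate: for every open `U ⊆ ℂ` and every `g : ℂ → ℝ⁴`, `C^∞` and
`J₀`-holomorphic on `U` with `‖g‖ < R` there, the density `μ = ‖∂ₓg‖²/(R² - ‖g‖²)` is `C²` on
`U` and satisfies `4 μ³ ≤ μ Δμ - |∇μ|²` on `U`.  Proof: the complex components `G₁, G₂` of `g`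
are holomorphic on `U` (`hasDerivAt_comp_of_J₀`), `‖∂ₓ g‖² = ‖G₁'‖² + ‖G₂'‖²`,
`‖g‖² = ‖G₁‖² + ‖G₂‖²`, and `model_ineq`. [folklore] -/
theorem stub_modelPair : ∀ (R : ℝ) (U : Set ℂ) (g : ℂ → EuclideanSpace ℝ (Fin 4)), 0 < R → IsOpen U →
      ContDiffOn ℝ ∞ g U →
      (∀ z ∈ U, ∀ ζ : ℂ, fderiv ℝ g z (Complex.I * ζ) = stdComplexStructure (fderiv ℝ g z ζ)) →
      (∀ z ∈ U, ‖g z‖ < R) →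
      ContDiffOn ℝ 2 (fun z => ‖fderiv ℝ g z 1‖ ^ 2 / (R ^ 2 - ‖g z‖ ^ 2)) U ∧
      ∀ z ∈ U, 2 * 2 * (‖fderiv ℝ g z 1‖ ^ 2 / (R ^ 2 - ‖g z‖ ^ 2)) ^ 3 ≤
        ‖fderiv ℝ g z 1‖ ^ 2 / (R ^ 2 - ‖g z‖ ^ 2) *
            (Δ (fun w => ‖fderiv ℝ g w 1‖ ^ 2 / (R ^ 2 - ‖g w‖ ^ 2))) z -
          ((fderiv ℝ (fun w => ‖fderiv ℝ g w 1‖ ^ 2 / (R ^ 2 - ‖g w‖ ^ 2)) z 1) ^ 2 +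
            (fderiv ℝ (fun w => ‖fderiv ℝ g w 1‖ ^ 2 / (R ^ 2 - ‖g w‖ ^ 2)) z Complex.I) ^ 2) := by
  intro R U g _hR hU hg hJ hgR
  -- the two complex coordinates `ℝ⁴ → ℂ`, `(a₀, a₁, a₂, a₃) ↦ a₀ + i a₁, a₂ + i a₃`
  set L₁ : EuclideanSpace ℝ (Fin 4) →L[ℝ] ℂ :=
    (EuclideanSpace.proj (0 : Fin 4) : EuclideanSpace ℝ (Fin 4) →L[ℝ] ℝ).smulRight (1 : ℂ) +
      (EuclideanSpace.proj (1 : Fin 4) : EuclideanSpace ℝ (Fin 4) →L[ℝ] ℝ).smulRight I with hL₁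
  set L₂ : EuclideanSpace ℝ (Fin 4) →L[ℝ] ℂ :=
    (EuclideanSpace.proj (2 : Fin 4) : EuclideanSpace ℝ (Fin 4) →L[ℝ] ℝ).smulRight (1 : ℂ) +
      (EuclideanSpace.proj (3 : Fin 4) : EuclideanSpace ℝ (Fin 4) →L[ℝ] ℝ).smulRight I with hL₂
  have hL₁a : ∀ u : EuclideanSpace ℝ (Fin 4), L₁ u = ⟨u 0, u 1⟩ := fun u => by
    apply Complex.ext <;> simp [hL₁]
  have hL₂a : ∀ u : EuclideanSpace ℝ (Fin 4), L₂ u = ⟨u 2, u 3⟩ := fun u => by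
    apply Complex.ext <;> simp [hL₂]
  -- `‖u‖² = ‖L₁ u‖² + ‖L₂ u‖²`
  have hnorm : ∀ u : EuclideanSpace ℝ (Fin 4), ‖u‖ ^ 2 = ‖L₁ u‖ ^ 2 + ‖L₂ u‖ ^ 2 := fun u => by
    rw [EuclideanSpace.norm_sq_eq, Fin.sum_univ_four, hL₁a, hL₂a, Complex.sq_norm, Complex.sq_norm,
      Complex.normSq_mk, Complex.normSq_mk]
    simp only [Real.norm_eq_abs, sq_abs]
    ring
  -- `J₀` read through `L_k` is multiplication by `i`
  have hJ₁ : ∀ u : EuclideanSpace ℝ (Fin 4), L₁ (stdComplexStructure u) = I * L₁ u := fun u => by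
    rw [hL₁a, hL₁a]
    apply Complex.ext <;> simp
  have hJ₂ : ∀ u : EuclideanSpace ℝ (Fin 4), L₂ (stdComplexStructure u) = I * L₂ u := fun u => by
    rw [hL₂a, hL₂a]
    apply Complex.ext <;> simp
  -- the holomorphic components of `g`
  set G₁ : ℂ → ℂ := fun w => L₁ (g w) with hG₁
  set G₂ : ℂ → ℂ := fun w => L₂ (g w) with hG₂
  have hd₁ : ∀ w ∈ U, HasDerivAt G₁ (L₁ (fderiv ℝ g w 1)) w := fun w hw =>
    hasDerivAt_comp_of_J₀ hU hg hJ L₁ hJ₁ hw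
  have hd₂ : ∀ w ∈ U, HasDerivAt G₂ (L₂ (fderiv ℝ g w 1)) w := fun w hw =>
    hasDerivAt_comp_of_J₀ hU hg hJ L₂ hJ₂ hw
  have hD₁ : DifferentiableOn ℂ G₁ U := fun w hw => (hd₁ w hw).differentiableAt.differentiableWithinAt
  have hD₂ : DifferentiableOn ℂ G₂ U := fun w hw => (hd₂ w hw).differentiableAt.differentiableWithinAt
  -- numerator and denominator in complex coordinates
  have hNeq : ∀ w ∈ U, ‖fderiv ℝ g w 1‖ ^ 2 = ‖deriv G₁ w‖ ^ 2 + ‖deriv G₂ w‖ ^ 2 := fun w hw => by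
    rw [(hd₁ w hw).deriv, (hd₂ w hw).deriv]
    exact hnorm _
  have hKeq : ∀ w, ‖g w‖ ^ 2 = ‖G₁ w‖ ^ 2 + ‖G₂ w‖ ^ 2 := fun w => hnorm (g w)
  have hlt : ∀ w ∈ U, ‖G₁ w‖ ^ 2 + ‖G₂ w‖ ^ 2 < R ^ 2 := fun w hw => by
    rw [← hKeq]
    have h := hgR w hw
    have h0 := norm_nonneg (g w)
    nlinarith
  have hμ : ∀ w ∈ U, ‖fderiv ℝ g w 1‖ ^ 2 / (R ^ 2 - ‖g w‖ ^ 2) =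
      (‖deriv G₁ w‖ ^ 2 + ‖deriv G₂ w‖ ^ 2) / (R ^ 2 - (‖G₁ w‖ ^ 2 + ‖G₂ w‖ ^ 2)) := fun w hw => by
    rw [hNeq w hw, hKeq]
  have hμev : ∀ z ∈ U, (fun w => ‖fderiv ℝ g w 1‖ ^ 2 / (R ^ 2 - ‖g w‖ ^ 2)) =ᶠ[𝓝 z]
      fun w => (‖deriv G₁ w‖ ^ 2 + ‖deriv G₂ w‖ ^ 2) / (R ^ 2 - (‖G₁ w‖ ^ 2 + ‖G₂ w‖ ^ 2)) :=
    fun z hz => by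
    filter_upwards [hU.mem_nhds hz] with w hw
    exact hμ w hw
  refine ⟨?_, fun z hz => ?_⟩
  · -- regularity, from that of the model density
    have hC : ContDiffOn ℝ 2 (fun w => (‖deriv G₁ w‖ ^ 2 + ‖deriv G₂ w‖ ^ 2) /
        (R ^ 2 - (‖G₁ w‖ ^ 2 + ‖G₂ w‖ ^ 2))) U := fun w hw =>
      (model_contDiffAt hU hD₁ hD₂ hlt hw).contDiffWithinAt
    exact hC.congr fun w hw => hμ w hw
  · -- the inequality, from the model inequality: `Δ`, `fderiv` and the value only see germs
    rw [(hμev z hz).fderiv_eq, (InnerProductSpace.laplacian_congr_nhds (hμev z hz)).eq_of_nhds,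
      hμ z hz]
    exact model_ineq hU hD₁ hD₂ hlt hz

end Summit.SmoothPoincare4.SmoothPoincare4.Cruxes.HyperbolicEnd.Sketch

end
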